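import Literature.Analysis.FunctionSpaces.LadyzhenskayaTorus
import HarnessLib

/-!
# The Sobolev embedding `H¹(T^d) ⊂ L⁴(T^d)` in dimensions `d ≤ 4`

Analysis/FunctionSpaces file (serves the energy equation of steady weak solutions of the
space-periodic Navier–Stokes equations in dimensions `d ≤ 4`,
`Literature.Analysis.FluidPDE.Torus.Temam1979_steadyWeakSolution_energy_eq`, whose printed proof —
Temam 1979, Ch. II §1, Lemma 1.2 / (1.13) with (1.21)–(1.22) — rests on the continuity of the
trilinear form `b` on `V × V × V` for `n ≤ 4`, i.e. on the embedding `H¹ ⊂ L⁴`: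
"`H¹₀(Ω) ⊂ L⁴(Ω)` for `n ≤ 4` by the Sobolev embedding theorem").

The two-dimensional case is Ladyzhenskaya's inequality, in the tree
(`Torus.lintegral_enorm_pow_four_le_of_memLp`, `LadyzhenskayaTorus`). This file adds the
dimensions `3` and `4` (where `4` is the critical Sobolev exponent, `2* = 2d/(d−2) = 4` for
`d = 4`) and packages the range `2 ≤ d ≤ 4` uniformly:

* `Torus.norm_fderiv_cutoff_smul_le` — the derivative of the cut-off lift `U = χ • (v ∘ proj)`,
  `‖DU‖ ≤ 𝟙_{supp χ} (‖D(v∘proj)‖ + ‖Dχ‖_∞ ‖v ∘ proj‖)`;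
* `Torus.lintegral_enorm_pow_four_le_sq_of_isSmooth` — for smooth `v : T^d → F'` (`F'` finite
  dimensional), `3 ≤ card d ≤ 4`: `∫ ‖v‖⁴ ≤ K (∫ ‖v‖² + ∫ ‖Dv‖²)²`, from Mathlib's
  Gagliardo–Nirenberg–Sobolev inequality with `p = 2`, `q = 4`
  (`MeasureTheory.eLpNorm_le_eLpNorm_fderiv_of_le`, admissible iff `1/2 − 1/d ≤ 1/4`, i.e. `d ≤ 4`,
  and `2 < d`) applied to `U`, the unit cube being a fundamental domain
  (`Torus.setLIntegral_unitCube_lift`) and the support ball being covered by finitely many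
  lattice translates of it (`Torus.setLIntegral_lift_le`) — the transfer already used for
  Ladyzhenskaya's inequality in `LadyzhenskayaTorus`;
* `Torus.lintegral_enorm_pow_four_le_of_memLp_of_three_le` — for `v ∈ L²(T^d; ℝ^d)`,
  `3 ≤ card d ≤ 4`: `∫ ‖v‖⁴ ≤ K ‖complexify ∘ v‖⁴_{H¹}` with the spectral norm
  `Torus.eSobolevNorm 1` (Parseval bookkeeping, Fourier truncation, a.e. convergence along a
  subsequence and Fatou, verbatim the scheme of `lintegral_enorm_pow_four_le_of_memLp`);
* `Torus.lintegral_enorm_pow_four_le_eSobolevNorm` — **the embedding `H¹(T^d) ⊂ L⁴(T^d)` for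
  `2 ≤ card d ≤ 4`**: `∫ ‖v‖⁴ ≤ K ‖complexify ∘ v‖⁴_{H¹}` for all `v ∈ L²` (dimension `2` from
  Ladyzhenskaya's inequality and `‖v‖²_{L²} ≤ 4π² ‖v‖²_{H¹}`).

Constants are not tracked (they depend on `d` through Mathlib's GNS constant, the lattice
covering number and a fixed bump function).

## Mathlib / tree search

Mathlib (this pin): the GNS inequality for `C¹` functions with bounded support in all three
forms (`eLpNorm_le_eLpNorm_fderiv_one`, `…_of_eq_inner`, `…_of_eq`, `…_of_le`), nothing periodic
and no Sobolev embedding on `AddCircle`/`UnitAddTorus` (searched `UnitAddTorus` with `eLpNorm`,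
`Sobolev`: none). Tree: `LadyzhenskayaTorus` (`card d = 2`, `L⁴` through `‖v‖₂‖v‖_{H¹}`),
`TorusAnisotropicLadyzhenskaya` (`Fin 3`, sliced estimate with one factor independent of `x₃`),
`FluidPDE/MultiplicativeInequality` (`ℝ³`, `L^{10/3}`), `SobolevFourierEmbedding` (`H^s ⊂ C^k` on
`ℝ^d`); no isotropic `L⁴` bound on `T³`/`T⁴` (searched `pow_four`, `L4`, `Sobolev` under
`FunctionSpaces/Torus*`).

## References

* R. Temam, *Navier–Stokes Equations: Theory and Numerical Analysis*, North-Holland (1979),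
  Ch. II §1.1, Lemma 1.2 and (1.13) (`b` trilinear continuous on `H¹₀(Ω)³`, `n ≤ 4`, by the
  Sobolev embedding `H¹ ⊂ L⁴`). [Temam1979]
* L. C. Evans, *Partial Differential Equations*, 2nd ed., AMS (2010), §5.6.1, Thm. 1
  (Gagliardo–Nirenberg–Sobolev) and Thm. 2 (`W^{1,p} ⊂ L^{p*}` on bounded `U`). [Evans2010]
* C. Foias, O. Manley, R. Rosa, R. Temam, *Navier–Stokes Equations and Turbulence*, CUP (2001),
  Ch. II App. A, (A.26)–(A.29) (Sobolev/Ladyzhenskaya inequalities behind the trilinear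
  estimates, `d = 2, 3`). [FMRT2001]
-/

noncomputable section

open MeasureTheory Set Filter Function Metric Module UnitAddTorus
open scoped ENNReal NNReal InnerProductSpace Topology ContDiff

namespace Literature.Analysis.FunctionSpaces

namespace Torus

variable {d : Type*} [Fintype d] [DecidableEq d]

/-! ### The smooth case via Gagliardo–Nirenberg–Sobolev (`p = 2`) on `ℝ^d`, `d = 3, 4` -/

section Smooth

variable {F' : Type*} [NormedAddCommGroup F'] [NormedSpace ℝ F']

omit [Fintype d] [DecidableEq d] in
/-- In `ℝ≥0∞`, `(x + y)² ≤ 4 (x² + y²)`. [folklore] -/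
private theorem add_sq_le_four_mul (x y : ℝ≥0∞) : (x + y) ^ 2 ≤ 4 * (x ^ 2 + y ^ 2) := by
  rcases le_total x y with h | h
  · calc (x + y) ^ 2 ≤ (y + y) ^ 2 := by gcongr
      _ = 4 * y ^ 2 := by ring
      _ ≤ 4 * (x ^ 2 + y ^ 2) := by gcongr; exact le_add_self
  · calc (x + y) ^ 2 ≤ (x + x) ^ 2 := by gcongr
      _ = 4 * x ^ 2 := by ring
      _ ≤ 4 * (x ^ 2 + y ^ 2) := by gcongr; exact le_self_add

omit [DecidableEq d] in
/-- The derivative of the cut-off lift `U = χ • w`: `‖DU‖ ≤ ‖Dw‖ + M ‖w‖` on the topological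
support of `χ` (`|χ| ≤ 1`, `‖Dχ‖ ≤ M`), and `DU = 0` off it. [folklore] -/
theorem norm_fderiv_cutoff_smul_le {E : Type*} [NormedAddCommGroup E] [NormedSpace ℝ E]
    {χ : E → ℝ} {w : E → F'} (hχ : Differentiable ℝ χ) (hw : Differentiable ℝ w)
    (hχ1 : ∀ y, |χ y| ≤ 1) {M : ℝ} (hM : ∀ y, ‖_root_.fderiv ℝ χ y‖ ≤ M) (y : E) :
    ‖_root_.fderiv ℝ (fun y => χ y • w y) y‖ ≤
      (tsupport χ).indicator (fun y => ‖_root_.fderiv ℝ w y‖ + M * ‖w y‖) y := by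
  have hU : HasFDerivAt (fun y => χ y • w y)
      (χ y • _root_.fderiv ℝ w y + (_root_.fderiv ℝ χ y).smulRight (w y)) y :=
    (hχ y).hasFDerivAt.fun_smul (hw y).hasFDerivAt
  rw [hU.fderiv]
  by_cases hy : y ∈ tsupport χ
  · rw [indicator_of_mem hy]
    calc ‖χ y • _root_.fderiv ℝ w y + (_root_.fderiv ℝ χ y).smulRight (w y)‖
        ≤ ‖χ y • _root_.fderiv ℝ w y‖ + ‖(_root_.fderiv ℝ χ y).smulRight (w y)‖ := norm_add_le _ _
      _ = |χ y| * ‖_root_.fderiv ℝ w y‖ + ‖_root_.fderiv ℝ χ y‖ * ‖w y‖ := by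
          rw [norm_smul, Real.norm_eq_abs, ContinuousLinearMap.norm_smulRight_apply]
      _ ≤ 1 * ‖_root_.fderiv ℝ w y‖ + M * ‖w y‖ := by
          gcongr
          · exact hχ1 y
          · exact hM y
      _ = ‖_root_.fderiv ℝ w y‖ + M * ‖w y‖ := by rw [one_mul]
  · rw [indicator_of_notMem hy]
    have hχ0 : χ y = 0 := image_eq_zero_of_notMem_tsupport hy
    have hDχ0 : _root_.fderiv ℝ χ y = 0 := by
      by_contra h
      exact hy (support_fderiv_subset ℝ (mem_support.2 h))
    simp [hχ0, hDχ0]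

variable [FiniteDimensional ℝ F']

/-- **The Sobolev inequality `H¹ ⊂ L⁴` for smooth fields on a torus of dimension `3` or `4`**
(Temam 1979, Ch. II §1.1, (1.13)/Lemma 1.2: the embedding behind the continuity of `b` for
`n ≤ 4`; Evans 2010, §5.6.1 Thms. 1–2): there is `K` (depending only on the index type `d`,
`3 ≤ card d ≤ 4`, and the finite-dimensional target `F'`) such that for every smooth
`v : T^d → F'`, `∫ ‖v‖⁴ ≤ K (∫ ‖v‖² + ∫ ‖Dv‖²)²`, `Dv = Torus.fderiv v` with the operator norm.
Proof: Mathlib's Gagliardo–Nirenberg–Sobolev inequality with `p = 2`, `q = 4`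
(`eLpNorm_le_eLpNorm_fderiv_of_le`; `1/2 − 1/d ≤ 1/4` iff `d ≤ 4`) for the cut-off lift
`U = χ • (v ∘ proj)` on `ℝ^d`, `χ` a bump equal to `1` on the unit cube, and the lattice
transfer of `LadyzhenskayaTorus`. [cite: Temam1979, Ch. II §1.1 Lemma 1.2, (1.13)] -/
theorem lintegral_enorm_pow_four_le_sq_of_isSmooth (hd3 : 3 ≤ Fintype.card d)
    (hd4 : Fintype.card d ≤ 4) :
    ∃ K : ℝ≥0, ∀ v : UnitAddTorus d → F', IsSmooth v →
      ∫⁻ x, ‖v x‖ₑ ^ 4 ≤ K * ((∫⁻ x, ‖v x‖ₑ ^ 2) + ∫⁻ x, ‖Torus.fderiv v x‖ₑ ^ 2) ^ 2 := by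
  classical
  -- ### the ambient space, the cutoff and the constants
  have hd0 : 0 < Fintype.card d := by omega
  let χ : ContDiffBump (0 : EuclideanSpace ℝ d) :=
    ⟨Fintype.card d, Fintype.card d + 1, by exact_mod_cast hd0, by linarith⟩
  have hχr : χ.rOut = Fintype.card d + 1 := rfl
  have hχi : χ.rIn = Fintype.card d := rfl
  have hχd : Differentiable ℝ χ := (χ.contDiff (n := 1)).differentiable one_ne_zero
  obtain ⟨M, hM⟩ : ∃ M, ∀ y, ‖_root_.fderiv ℝ (χ : EuclideanSpace ℝ d → ℝ) y‖ ≤ M :=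
    ((χ.contDiff (n := 1)).continuous_fderiv one_ne_zero).bounded_above_of_compact_support
      (χ.hasCompactSupport.fderiv (𝕜 := ℝ))
  have hM0 : 0 ≤ M := (norm_nonneg _).trans (hM 0)
  set n : ℕ := Fintype.card d + 2 with hn
  have hnR : χ.rOut + 1 ≤ n := by rw [hχr, hn]; push_cast; linarith
  set N : ℝ≥0∞ := ((latticeWindow d n).card : ℝ≥0∞) with hN
  set S : Set (EuclideanSpace ℝ d) := closedBall 0 χ.rOut with hS
  have hSt : tsupport (χ : EuclideanSpace ℝ d → ℝ) = S := χ.tsupport_eq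
  set C₁ : ℝ≥0 := eLpNormLESNormFDerivOfLeConst F' (volume : Measure (EuclideanSpace ℝ d)) S 2 4
    with hC₁
  set Mn : ℝ≥0 := Real.toNNReal M with hMn
  have hMMn : ENNReal.ofReal M = (Mn : ℝ≥0∞) := rfl
  -- GNS exponents: `p = 2 < d`, `1/2 - 1/d ≤ 1/4`
  have h2p : (2 : ℝ≥0) < finrank ℝ (EuclideanSpace ℝ d) := by
    rw [finrank_euclideanSpace]
    exact_mod_cast (show (2 : ℕ) < Fintype.card d by omega)
  have hpq : (2 : ℝ≥0)⁻¹ - (finrank ℝ (EuclideanSpace ℝ d) : ℝ)⁻¹ ≤ ((4 : ℝ≥0) : ℝ)⁻¹ := by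
    rw [finrank_euclideanSpace]
    have h4 : (Fintype.card d : ℝ) ≤ 4 := by exact_mod_cast hd4
    have h3 : (3 : ℝ) ≤ Fintype.card d := by exact_mod_cast hd3
    have hinv : (4 : ℝ)⁻¹ ≤ (Fintype.card d : ℝ)⁻¹ := by
      rw [inv_le_inv₀ (by norm_num) (by linarith)]
      exact h4
    push_cast
    linarith
  refine ⟨16 * C₁ ^ 4 * ((latticeWindow d n).card : ℝ≥0) ^ 2 * (max 1 (Mn ^ 2)) ^ 2, fun v hv => ?_⟩
  -- ### the lift and the test function `U = χ • w`
  set w : EuclideanSpace ℝ d → F' := lift v with hw_def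
  have hw : ContDiff ℝ (⊤ : ℕ∞) w := hv
  have hwd : Differentiable ℝ w := hw.differentiable (by simp)
  set U : EuclideanSpace ℝ d → F' := fun y => χ y • w y with hU_def
  have hUc1 : ContDiff ℝ 1 U := (χ.contDiff (n := 1)).smul (hw.of_le (by simp))
  have hUsupp : U.support ⊆ S := by
    rw [← hSt]
    exact (support_smul_subset_left _ _).trans (subset_tsupport _)
  -- ### GNS: `‖U‖_{L⁴} ≤ C₁ ‖DU‖_{L²}`, i.e. `∫ ‖U‖⁴ ≤ C₁⁴ (∫ ‖DU‖²)²`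
  have hGNS : eLpNorm U ((4 : ℝ≥0) : ℝ≥0∞) volume ≤
      C₁ * eLpNorm (_root_.fderiv ℝ U) ((2 : ℝ≥0) : ℝ≥0∞) volume :=
    eLpNorm_le_eLpNorm_fderiv_of_le volume hUc1 hUsupp (by norm_num) h2p hpq isBounded_closedBall
  have hr4 : ∀ x : ℝ≥0∞, x ^ (4 : ℝ) = x ^ 4 := fun x => by
    rw [show (4 : ℝ) = (4 : ℕ) by norm_num, ENNReal.rpow_natCast]
  have hGNS' : ∫⁻ y, ‖U y‖ₑ ^ 4 ≤ (C₁ : ℝ≥0∞) ^ 4 * (∫⁻ y, ‖_root_.fderiv ℝ U y‖ₑ ^ 2) ^ 2 := by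
    rw [eLpNorm_nnreal_eq_lintegral (by norm_num), eLpNorm_nnreal_eq_lintegral (by norm_num)] at hGNS
    have h := ENNReal.rpow_le_rpow hGNS (show (0 : ℝ) ≤ 4 by norm_num)
    rw [← ENNReal.rpow_mul, ENNReal.mul_rpow_of_nonneg _ _ (by norm_num), ← ENNReal.rpow_mul] at h
    norm_num at h
    simpa only [hr4, ENNReal.rpow_two] using h
  -- ### the left-hand side: `∫_{T^d} ‖v‖⁴ ≤ ∫ ‖U‖⁴`
  set a : ℝ≥0∞ := ∫⁻ x, ‖v x‖ₑ ^ 2 with ha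
  set b : ℝ≥0∞ := ∫⁻ x, ‖Torus.fderiv v x‖ₑ ^ 2 with hb
  have hLHS : ∫⁻ x, ‖v x‖ₑ ^ 4 ≤ ∫⁻ y, ‖U y‖ₑ ^ 4 := by
    have hmeas : AEMeasurable (fun x => ‖v x‖ₑ ^ 4) volume :=
      (hv.continuous.enorm.measurable.pow_const 4).aemeasurable
    have hcube : ∀ y ∈ unitCube d, ‖U y‖ₑ ^ 4 = lift (fun x => ‖v x‖ₑ ^ 4) y := by
      intro y hy
      have hχ1 : χ y = 1 := χ.one_of_mem_closedBall (by
        rw [mem_closedBall, dist_zero_right, hχi]; exact norm_le_card_of_mem_unitCube hy)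
      simp only [hU_def, hχ1, one_smul, lift_apply, hw_def]
    calc ∫⁻ x, ‖v x‖ₑ ^ 4 = ∫⁻ y in unitCube d, lift (fun x => ‖v x‖ₑ ^ 4) y :=
          (setLIntegral_unitCube_lift hmeas).symm
      _ = ∫⁻ y in unitCube d, ‖U y‖ₑ ^ 4 := (setLIntegral_congr_fun measurableSet_unitCube hcube).symm
      _ ≤ ∫⁻ y, ‖U y‖ₑ ^ 4 := setLIntegral_le_lintegral _ _
  -- ### the derivative of `U`
  have hDU : ∀ y, ‖_root_.fderiv ℝ U y‖ₑ ^ 2 ≤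
      S.indicator (fun y => 4 * (‖_root_.fderiv ℝ w y‖ₑ ^ 2 + (Mn : ℝ≥0∞) ^ 2 * ‖w y‖ₑ ^ 2)) y := by
    intro y
    have h := norm_fderiv_cutoff_smul_le (w := w) hχd hwd
      (fun y => by rw [abs_of_nonneg χ.nonneg]; exact χ.le_one) hM y
    rw [hSt] at h
    by_cases hy : y ∈ S
    · rw [indicator_of_mem hy] at h
      rw [indicator_of_mem hy, ← ofReal_norm]
      have h' : ENNReal.ofReal ‖_root_.fderiv ℝ U y‖ ≤ ‖_root_.fderiv ℝ w y‖ₑ + Mn * ‖w y‖ₑ := by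
        refine (ENNReal.ofReal_le_ofReal h).trans (le_of_eq ?_)
        rw [ENNReal.ofReal_add (norm_nonneg _) (by positivity), ofReal_norm,
          ENNReal.ofReal_mul hM0, hMMn, ofReal_norm]
      calc ENNReal.ofReal ‖_root_.fderiv ℝ U y‖ ^ 2 ≤ (‖_root_.fderiv ℝ w y‖ₑ + Mn * ‖w y‖ₑ) ^ 2 := by
            gcongr
        _ ≤ 4 * (‖_root_.fderiv ℝ w y‖ₑ ^ 2 + (Mn * ‖w y‖ₑ) ^ 2) := add_sq_le_four_mul _ _
        _ = 4 * (‖_root_.fderiv ℝ w y‖ₑ ^ 2 + (Mn : ℝ≥0∞) ^ 2 * ‖w y‖ₑ ^ 2) := by ring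
    · rw [indicator_of_notMem hy] at h
      rw [indicator_of_notMem hy]
      have h0 : ‖_root_.fderiv ℝ U y‖ = 0 := le_antisymm h (norm_nonneg _)
      rw [← ofReal_norm, h0, ENNReal.ofReal_zero, zero_pow two_ne_zero]
  -- ### measurability of the lifted densities
  have hwm : AEMeasurable (fun y => ‖w y‖ₑ ^ 2) volume :=
    (hw.continuous.enorm.measurable.pow_const 2).aemeasurable
  have hDwm : AEMeasurable (fun y => ‖_root_.fderiv ℝ w y‖ₑ ^ 2) volume :=
    ((hw.continuous_fderiv (by simp)).enorm.measurable.pow_const 2).aemeasurable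
  -- ### lattice bounds: `∫_S ‖w‖² ≤ N a`, `∫_S ‖Dw‖² ≤ N b`
  have hSa : ∫⁻ y in S, ‖w y‖ₑ ^ 2 ≤ N * a :=
    setLIntegral_lift_le (H := fun x => ‖v x‖ₑ ^ 2)
      (hv.continuous.enorm.measurable.pow_const 2).aemeasurable (subset_refl S) hnR
  have hSb : ∫⁻ y in S, ‖_root_.fderiv ℝ w y‖ₑ ^ 2 ≤ N * b := by
    have hTf : (fun x => ‖Torus.fderiv v x‖ₑ ^ 2) =
        fun x => ‖_root_.fderiv ℝ w (repr x)‖ₑ ^ 2 := by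
      funext x
      rw [hw_def, fderiv_lift, proj_repr]
    have hmeasT : AEMeasurable (fun x => ‖Torus.fderiv v x‖ₑ ^ 2) volume := by
      rw [hTf]
      exact (((hw.continuous_fderiv (by simp)).measurable.comp measurable_repr).enorm.pow_const
        2).aemeasurable
    have h := setLIntegral_lift_le (H := fun x => ‖Torus.fderiv v x‖ₑ ^ 2) hmeasT (subset_refl S) hnR
    have hlift : (lift fun x => ‖Torus.fderiv v x‖ₑ ^ 2) = fun y => ‖_root_.fderiv ℝ w y‖ₑ ^ 2 := by
      funext y
      rw [lift_apply, hw_def, fderiv_lift]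
    rw [hlift] at h
    exact h
  -- ### `∫ ‖DU‖² ≤ 4 N (b + Mn² a)`
  have hL : ∫⁻ y, ‖_root_.fderiv ℝ U y‖ₑ ^ 2 ≤ 4 * (N * b + (Mn : ℝ≥0∞) ^ 2 * (N * a)) := by
    calc ∫⁻ y, ‖_root_.fderiv ℝ U y‖ₑ ^ 2
        ≤ ∫⁻ y, S.indicator (fun y => 4 * (‖_root_.fderiv ℝ w y‖ₑ ^ 2 + (Mn : ℝ≥0∞) ^ 2 * ‖w y‖ₑ ^ 2)) y :=
          lintegral_mono hDU
      _ = ∫⁻ y in S, 4 * (‖_root_.fderiv ℝ w y‖ₑ ^ 2 + (Mn : ℝ≥0∞) ^ 2 * ‖w y‖ₑ ^ 2) :=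
          lintegral_indicator measurableSet_closedBall _
      _ = 4 * ((∫⁻ y in S, ‖_root_.fderiv ℝ w y‖ₑ ^ 2) + (Mn : ℝ≥0∞) ^ 2 * ∫⁻ y in S, ‖w y‖ₑ ^ 2) := by
          rw [lintegral_const_mul' _ _ ENNReal.ofNat_ne_top, lintegral_add_left' hDwm.restrict,
            lintegral_const_mul' _ _ (ENNReal.pow_ne_top ENNReal.coe_ne_top)]
      _ ≤ 4 * (N * b + (Mn : ℝ≥0∞) ^ 2 * (N * a)) := by gcongr
  -- ### assembly of the estimate
  have hmax1 : (1 : ℝ≥0∞) ≤ ((max 1 (Mn ^ 2) : ℝ≥0) : ℝ≥0∞) := by exact_mod_cast le_max_left _ _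
  have hmax2 : (Mn : ℝ≥0∞) ^ 2 ≤ ((max 1 (Mn ^ 2) : ℝ≥0) : ℝ≥0∞) := by
    have : ((Mn ^ 2 : ℝ≥0) : ℝ≥0∞) ≤ ((max 1 (Mn ^ 2) : ℝ≥0) : ℝ≥0∞) := by exact_mod_cast le_max_right _ _
    simpa only [ENNReal.coe_pow] using this
  have hkey : N * b + (Mn : ℝ≥0∞) ^ 2 * (N * a) ≤ N * ((max 1 (Mn ^ 2) : ℝ≥0) : ℝ≥0∞) * (a + b) := by
    calc N * b + (Mn : ℝ≥0∞) ^ 2 * (N * a) = N * (1 * b + (Mn : ℝ≥0∞) ^ 2 * a) := by ring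
      _ ≤ N * (((max 1 (Mn ^ 2) : ℝ≥0) : ℝ≥0∞) * b + ((max 1 (Mn ^ 2) : ℝ≥0) : ℝ≥0∞) * a) := by
          gcongr
      _ = N * ((max 1 (Mn ^ 2) : ℝ≥0) : ℝ≥0∞) * (a + b) := by ring
  calc ∫⁻ x, ‖v x‖ₑ ^ 4 ≤ ∫⁻ y, ‖U y‖ₑ ^ 4 := hLHS
    _ ≤ (C₁ : ℝ≥0∞) ^ 4 * (∫⁻ y, ‖_root_.fderiv ℝ U y‖ₑ ^ 2) ^ 2 := hGNS'
    _ ≤ (C₁ : ℝ≥0∞) ^ 4 * (4 * (N * b + (Mn : ℝ≥0∞) ^ 2 * (N * a))) ^ 2 := by gcongr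
    _ ≤ (C₁ : ℝ≥0∞) ^ 4 * (4 * (N * ((max 1 (Mn ^ 2) : ℝ≥0) : ℝ≥0∞) * (a + b))) ^ 2 := by gcongr
    _ = (((16 * C₁ ^ 4 * ((latticeWindow d n).card : ℝ≥0) ^ 2 * (max 1 (Mn ^ 2)) ^ 2 : ℝ≥0)) : ℝ≥0∞) *
          (a + b) ^ 2 := by
        rw [hN]; push_cast; ring

end Smooth

/-! ### Extension to `L²` fields with finite `H¹` norm: truncation and Fatou -/

section Sobolev

/-- `∫ ‖u‖² + ∫ ‖Du‖² ≤ 64 d ‖complexify ∘ u‖²_{H¹}` for smooth real vector fields (operator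
norm of `Du` against the partial derivatives, Parseval, `4π² ≤ 64`). [folklore] -/
theorem lintegral_enorm_sq_add_lintegral_fderiv_sq_le {u : UnitAddTorus d → EuclideanSpace ℝ d}
    (hu : IsSmooth u) :
    (∫⁻ x, ‖u x‖ₑ ^ 2) + ∫⁻ x, ‖Torus.fderiv u x‖ₑ ^ 2 ≤
      Fintype.card d * (64 * eSobolevNorm 1 (EuclideanSpace.complexify ∘ u) ^ 2) := by
  have h4π : ENNReal.ofReal (4 * Real.pi ^ 2) ≤ 64 := by
    have h : 4 * Real.pi ^ 2 ≤ 64 := by nlinarith [Real.pi_le_four, Real.pi_gt_three]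
    calc ENNReal.ofReal (4 * Real.pi ^ 2) ≤ ENNReal.ofReal 64 := ENNReal.ofReal_le_ofReal h
      _ = 64 := by norm_num
  set a := ∫⁻ x, ‖u x‖ₑ ^ 2 with ha
  set H := eSobolevNorm 1 (EuclideanSpace.complexify ∘ u) ^ 2 with hH
  by_cases hd0 : Fintype.card d = 0
  · -- the torus is a point and the field is zero-dimensional: both integrands vanish
    haveI : IsEmpty d := Fintype.card_eq_zero_iff.1 hd0
    have h0 : ∀ x, ‖u x‖ₑ = 0 := fun x => by
      rw [Subsingleton.elim (u x) 0, enorm_zero]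
    have h0' : ∀ x, ‖Torus.fderiv u x‖ₑ = 0 := fun x => by
      rw [Subsingleton.elim (Torus.fderiv u x) 0, ← ofReal_norm, norm_zero, ENNReal.ofReal_zero]
    simp [ha, h0, h0']
  calc a + ∫⁻ x, ‖Torus.fderiv u x‖ₑ ^ 2 ≤ a + Fintype.card d * eGradNormSq u :=
        add_le_add le_rfl (lintegral_enorm_fderiv_sq_le_card_mul_eGradNormSq hu)
    _ ≤ Fintype.card d * a + Fintype.card d * eGradNormSq u := by
        refine add_le_add (le_mul_of_one_le_left bot_le ?_) le_rfl
        exact_mod_cast Nat.one_le_iff_ne_zero.2 hd0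
    _ = Fintype.card d * (a + eGradNormSq u) := by ring
    _ ≤ Fintype.card d * (ENNReal.ofReal (4 * Real.pi ^ 2) * H) :=
        mul_le_mul' le_rfl (lintegral_enorm_sq_add_eGradNormSq_le (hu.memLp 2))
    _ ≤ Fintype.card d * (64 * H) := by gcongr

/-- **The Sobolev inequality `H¹ ⊂ L⁴` on a torus of dimension `3` or `4`, `L²` fields**
(Temam 1979, Ch. II §1.1, Lemma 1.2/(1.13), space-periodic setting; Evans 2010, §5.6.1): on
`T^d` with `3 ≤ card d ≤ 4` there is `K` such that for every `v ∈ L²(T^d; ℝ^d)`,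
`∫ ‖v‖⁴ ≤ K ‖complexify ∘ v‖⁴_{H¹}` with the spectral `H¹` norm `Torus.eSobolevNorm 1` (both
sides in `[0, ∞]`; trivial when the norm is infinite). From the smooth case through the
truncations `P_N v` (`‖P_N v‖_{H¹} ≤ ‖v‖_{H¹}`, `P_N v → v` a.e. along a subsequence) and Fatou's
lemma. [cite: Temam1979, Ch. II §1.1 Lemma 1.2, (1.13)] -/
theorem lintegral_enorm_pow_four_le_of_memLp_of_three_le (hd3 : 3 ≤ Fintype.card d)
    (hd4 : Fintype.card d ≤ 4) :
    ∃ K : ℝ≥0, ∀ v : UnitAddTorus d → EuclideanSpace ℝ d, MemLp v 2 volume →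
      ∫⁻ x, ‖v x‖ₑ ^ 4 ≤ K * eSobolevNorm 1 (EuclideanSpace.complexify ∘ v) ^ 4 := by
  obtain ⟨K₀, hK₀⟩ :=
    lintegral_enorm_pow_four_le_sq_of_isSmooth (F' := EuclideanSpace ℝ d) hd3 hd4
  set K : ℝ≥0 := max 1 (K₀ * (Fintype.card d) ^ 2 * 4096) with hK
  have hK1 : (1 : ℝ≥0∞) ≤ K := by exact_mod_cast le_max_left _ _
  have hKK₀ : (K₀ : ℝ≥0∞) * (Fintype.card d) ^ 2 * 4096 ≤ K := by
    have h1 : K₀ * (Fintype.card d : ℝ≥0) ^ 2 * 4096 ≤ K := le_max_right _ _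
    have h2 := ENNReal.coe_le_coe.2 h1
    push_cast at h2
    exact h2
  -- ### the smooth case in spectral form
  have hsmooth : ∀ u : UnitAddTorus d → EuclideanSpace ℝ d, IsSmooth u →
      ∫⁻ x, ‖u x‖ₑ ^ 4 ≤ K * eSobolevNorm 1 (EuclideanSpace.complexify ∘ u) ^ 4 := by
    intro u hu
    set H := eSobolevNorm 1 (EuclideanSpace.complexify ∘ u) ^ 2 with hH
    have hH4 : eSobolevNorm 1 (EuclideanSpace.complexify ∘ u) ^ 4 = H ^ 2 := by rw [hH]; ring
    calc ∫⁻ x, ‖u x‖ₑ ^ 4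
        ≤ K₀ * ((∫⁻ x, ‖u x‖ₑ ^ 2) + ∫⁻ x, ‖Torus.fderiv u x‖ₑ ^ 2) ^ 2 := hK₀ u hu
      _ ≤ K₀ * (Fintype.card d * (64 * H)) ^ 2 := by
          gcongr
          exact lintegral_enorm_sq_add_lintegral_fderiv_sq_le hu
      _ = (K₀ * (Fintype.card d) ^ 2 * 4096) * H ^ 2 := by ring
      _ ≤ K * H ^ 2 := by gcongr
      _ = K * eSobolevNorm 1 (EuclideanSpace.complexify ∘ u) ^ 4 := by rw [hH4]
  -- ### general `L²` fields
  refine ⟨K, fun v hv => ?_⟩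
  set H := eSobolevNorm 1 (EuclideanSpace.complexify ∘ v) with hH
  -- infinite `H¹` norm
  by_cases hHtop : H = ⊤
  · rw [hHtop, ENNReal.top_pow, ENNReal.mul_top (ne_of_gt (lt_of_lt_of_le zero_lt_one hK1))]
    · exact le_top
    · norm_num
  -- finite `H¹` norm: truncate
  have hP : ∀ N, ∫⁻ x, ‖fourierTruncate N v x‖ₑ ^ 4 ≤ K * H ^ 4 := fun N =>
    calc ∫⁻ x, ‖fourierTruncate N v x‖ₑ ^ 4
        ≤ K * eSobolevNorm 1 (EuclideanSpace.complexify ∘ fourierTruncate N v) ^ 4 :=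
          hsmooth _ (isSmooth_fourierTruncate N v)
      _ ≤ K * H ^ 4 :=
          mul_le_mul' le_rfl
            (pow_le_pow_left₀ bot_le (eSobolevNorm_fourierTruncate_le (hv.integrable one_le_two) 1 N) 4)
  -- a.e. convergence along a subsequence
  have hmeasP : ∀ N, AEStronglyMeasurable (fourierTruncate N v) volume := fun N =>
    (continuous_fourierTruncate N v).aestronglyMeasurable
  have hTIM : TendstoInMeasure volume (fun N => fourierTruncate N v) atTop v :=
    tendstoInMeasure_of_tendsto_eLpNorm two_ne_zero hmeasP hv.1 (tendsto_eLpNorm_fourierTruncate_sub hv)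
  obtain ⟨ns, -, hns⟩ := hTIM.exists_seq_tendsto_ae
  have hc : Continuous fun z : EuclideanSpace ℝ d => ‖z‖ₑ ^ 4 := (ENNReal.continuous_pow 4).comp continuous_enorm
  have hlim : ∀ᵐ x ∂volume, Tendsto (fun i => ‖fourierTruncate (ns i) v x‖ₑ ^ 4) atTop (𝓝 (‖v x‖ₑ ^ 4)) := by
    filter_upwards [hns] with x hx
    exact (hc.tendsto (v x)).comp hx
  have hliminf : (fun x => ‖v x‖ₑ ^ 4) =ᵐ[volume]
      fun x => liminf (fun i => ‖fourierTruncate (ns i) v x‖ₑ ^ 4) atTop := by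
    filter_upwards [hlim] with x hx
    exact hx.liminf_eq.symm
  calc ∫⁻ x, ‖v x‖ₑ ^ 4 = ∫⁻ x, liminf (fun i => ‖fourierTruncate (ns i) v x‖ₑ ^ 4) atTop :=
        lintegral_congr_ae hliminf
    _ ≤ liminf (fun i => ∫⁻ x, ‖fourierTruncate (ns i) v x‖ₑ ^ 4) atTop :=
        lintegral_liminf_le' fun i =>
          ((continuous_fourierTruncate (ns i) v).enorm.measurable.pow_const 4).aemeasurable
    _ ≤ K * H ^ 4 := liminf_le_of_frequently_le (Eventually.of_forall fun i => hP (ns i)).frequently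

/-- **The Sobolev embedding `H¹(T^d) ⊂ L⁴(T^d)` for `2 ≤ d ≤ 4`** (Temam 1979, Ch. II §1.1,
(1.13) with Lemma 1.2: "for `n ≤ 4`, `H¹₀(Ω) ⊂ L⁴(Ω)`", space-periodic setting of Ch. I §1.4;
Evans 2010, §5.6.1): on `T^d` with `2 ≤ card d ≤ 4` there is `K` such that for every
`v ∈ L²(T^d; ℝ^d)`, `∫ ‖v‖⁴ ≤ K ‖complexify ∘ v‖⁴_{H¹}` (spectral `H¹` norm `Torus.eSobolevNorm 1`,
both sides in `[0, ∞]`). Dimension `2` is Ladyzhenskaya's inequality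
(`lintegral_enorm_pow_four_le_of_memLp`, `∫‖v‖⁴ ≤ K‖v‖²₂‖v‖²_{H¹}`) combined with
`‖v‖²_{L²} ≤ 4π²‖v‖²_{H¹}`; dimensions `3, 4` are
`lintegral_enorm_pow_four_le_of_memLp_of_three_le`. [cite: Temam1979, Ch. II §1.1 Lemma 1.2, (1.13)] -/
theorem lintegral_enorm_pow_four_le_eSobolevNorm (hd2 : 2 ≤ Fintype.card d)
    (hd4 : Fintype.card d ≤ 4) :
    ∃ K : ℝ≥0, ∀ v : UnitAddTorus d → EuclideanSpace ℝ d, MemLp v 2 volume →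
      ∫⁻ x, ‖v x‖ₑ ^ 4 ≤ K * eSobolevNorm 1 (EuclideanSpace.complexify ∘ v) ^ 4 := by
  by_cases hd : Fintype.card d = 2
  · obtain ⟨K₀, hK₀⟩ := lintegral_enorm_pow_four_le_of_memLp (d := d) hd
    refine ⟨K₀ * 64, fun v hv => ?_⟩
    have h4π : ENNReal.ofReal (4 * Real.pi ^ 2) ≤ 64 := by
      have h : 4 * Real.pi ^ 2 ≤ 64 := by nlinarith [Real.pi_le_four, Real.pi_gt_three]
      calc ENNReal.ofReal (4 * Real.pi ^ 2) ≤ ENNReal.ofReal 64 := ENNReal.ofReal_le_ofReal h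
        _ = 64 := by norm_num
    set H := eSobolevNorm 1 (EuclideanSpace.complexify ∘ v) with hH
    have ha : ∫⁻ x, ‖v x‖ₑ ^ 2 ≤ 64 * H ^ 2 :=
      calc ∫⁻ x, ‖v x‖ₑ ^ 2 ≤ (∫⁻ x, ‖v x‖ₑ ^ 2) + eGradNormSq v := le_self_add
        _ ≤ ENNReal.ofReal (4 * Real.pi ^ 2) * H ^ 2 := lintegral_enorm_sq_add_eGradNormSq_le hv
        _ ≤ 64 * H ^ 2 := by gcongr
    calc ∫⁻ x, ‖v x‖ₑ ^ 4 ≤ K₀ * (∫⁻ x, ‖v x‖ₑ ^ 2) * H ^ 2 := hK₀ v hv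
      _ ≤ K₀ * (64 * H ^ 2) * H ^ 2 := by gcongr
      _ = ((K₀ * 64 : ℝ≥0) : ℝ≥0∞) * H ^ 4 := by push_cast; ring
  · exact lintegral_enorm_pow_four_le_of_memLp_of_three_le (by omega) hd4

end Sobolev

end Torus

end Literature.Analysis.FunctionSpaces
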